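import Literature.NumberTheory.Automorphic.LieAlgebraGL
import Mathlib.LinearAlgebra.Dual.Lemmas
import Mathlib.Tactic.NoncommRing
import HarnessLib

/-!
# Lie algebras of stabilisers: `Lie(H)` preserves what `H` preserves (Springer 4.4.10–4.4.15)

Trunk T-AUTOMORPHIC (G25 AutomorphicL); companion of `LieAlgebraGL.lean` (namespace
`Literature.Automorphic`, concrete vocabulary: `lieAlgebraGL H ⊆ Matrix n n k`, the tangent space at `1`
of the Zariski closure of `H ≤ GL n k`, cut out by the differentials `tangentDeriv p` of the
vanishing ideal; dual-number points `dualPoint A`, `dualMatrix A = 1 + ε A`). The easy direction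
of the correspondence between a subgroup and its Lie algebra is an *upper bound*: every
polynomial identity satisfied by `H` linearises to an identity satisfied by `Lie(H)`. This file
proves the three instances needed to bound the Lie algebra of a group *constructed* from a Lie
algebra of matrices (Springer 10.2: the group `G ≤ GL(𝔤)` generated by `T` and the `exp (ξ ad e_α)`
normalises `ad 𝔤`, so `Lie(G)` normalises `ad 𝔤`; used towards `Literature.NumberTheory.Automorphic.chevalley_existence`,
the inclusion `R(G, T) ⊆ R`):

* `lie_mem_of_forall_conj_mem`: if `g L g⁻¹ ⊆ L` for all `g ∈ H` (`L` a subspace of matrices)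
  then `[A, L] ⊆ L` for all `A ∈ Lie(H)` (the differential of `Ad`, `d Ad(X)(Y) = [X, Y]`,
  Springer 4.4.15 / p. 89, applied to the identities defining the normaliser of `L`);
* `mulVec_mem_of_forall_mulVec_mem`: if `g W ⊆ W` for all `g ∈ H` (`W ⊆ kⁿ`) then
  `A W ⊆ W` for all `A ∈ Lie(H)` (the differential of a rational representation,
  Springer 4.4.15 (1), applied to the identities defining the stabiliser of `W`);
* `mulVec_eq_zero_of_forall_mulVec_eq`: if `g v = v` for all `g ∈ H` then `A v = 0`.

The proofs evaluate explicit coordinate polynomials at the point `1 + ε A`: the *calculus*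
section provides the product rule `tangentDeriv_mul`, `det (1 + ε A) = 1 + ε tr A`
(`det_dualMatrix`, Mathlib `Matrix.det_one_add_smul`), `adj (1 + ε A) = (1 + ε tr A)(1 - ε A)`
(`adjugate_dualMatrix`), hence the inverse coordinates `invPolyGL` take `1 + ε A` to `1 - ε A`
(`aeval_dualPoint_invPolyGL`: the differential of inversion is `A ↦ -A`, Springer 4.4.12), and
the differential of
`g ↦ g M g⁻¹` is `A ↦ A M - M A` (`tangentDeriv_conjConstPolyGL`); a vector killed by all linear
forms vanishing on a subspace lies in it (`mem_of_forall_dual_eq_zero`, Mathlib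
`Submodule.exists_dual_map_eq_bot_of_notMem`).

## Mathlib

Dual numbers `k[ε] = TrivSqZeroExt k k` (`DualNumber.eps_mul_eps`, `TrivSqZeroExt.snd_mul`,
`inr_mul_inr`), `Matrix.det_one_add_smul`, `Matrix.mul_adjugate`, `RingHom.map_adjugate`,
`LinearMap.pi_apply_eq_sum_univ`, `Matrix.matrix_eq_sum_single`. Mathlib has no algebraic groups
or their Lie algebras; nothing here duplicates a Mathlib declaration (`lean search` for
`tangentDeriv`, `lieAlgebraGL`: only `LieAlgebraGL.lean`).

## References

* [SpringerLAG1998] T. A. Springer, *Linear Algebraic Groups*, 2nd ed., Progress in Mathematics 9,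
  Birkhäuser (1998): 4.1.2–4.1.3, 4.4.5, 4.4.10 (3), 4.4.12, 4.4.15 (1), 10.2.
-/

noncomputable section

open scoped MatrixGroups DualNumber
open TrivSqZeroExt

namespace Literature.NumberTheory.Automorphic

variable {k : Type*} [Field k] {n : Type*} [Fintype n] [DecidableEq n]

/-! ### Calculus at `1 + ε A` -/

section DualCalculus

/-- The product rule for differentials at `1`: `d(pq)_1 = p(1) dq_1 + dp_1 q(1)`. [folklore] -/
lemma tangentDeriv_mul (p q : MvPolynomial (GLCoord n) k) (A : Matrix n n k) :
    tangentDeriv (p * q) A =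
      MvPolynomial.eval (glCoordFun (1 : GL n k)) p * tangentDeriv q A +
        tangentDeriv p A * MvPolynomial.eval (glCoordFun (1 : GL n k)) q := by
  rw [tangentDeriv, map_mul, snd_mul, fst_aeval_dualPoint, fst_aeval_dualPoint, smul_eq_mul,
    MulOpposite.smul_eq_mul_unop, MulOpposite.unop_op]
  rfl

/-- Differentials are `k`-linear in the polynomial: `d(a p)_1 = a dp_1`. [folklore] -/
lemma tangentDeriv_C_mul (a : k) (p : MvPolynomial (GLCoord n) k) (A : Matrix n n k) :
    tangentDeriv (MvPolynomial.C a * p) A = a * tangentDeriv p A := by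
  rw [tangentDeriv_mul, tangentDeriv_C, zero_mul, add_zero, MvPolynomial.eval_C]

/-- Differentials of sums. [folklore] -/
lemma tangentDeriv_sum {ι : Type*} (s : Finset ι) (p : ι → MvPolynomial (GLCoord n) k)
    (A : Matrix n n k) : tangentDeriv (∑ i ∈ s, p i) A = ∑ i ∈ s, tangentDeriv (p i) A := by
  classical
  induction s using Finset.induction_on with
  | empty => rw [Finset.sum_empty, Finset.sum_empty, ← MvPolynomial.C_0, tangentDeriv_C]
  | insert i s hi ih => rw [Finset.sum_insert hi, Finset.sum_insert hi, tangentDeriv_add, ih]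

omit [Fintype n] [DecidableEq n] in
/-- `ε (M - N) = ε M - ε N`. [folklore] -/
lemma map_inr_sub (M N : Matrix n n k) :
    (M - N).map (inr : k → k[ε]) = M.map inr - N.map inr :=
  Matrix.ext fun i j => map_sub (inrHom k k) (M i j) (N i j)

omit [DecidableEq n] in
/-- `(ε M) (ε N) = 0` for matrices over `k[ε]`. [folklore] -/
lemma map_inr_mul_map_inr (M N : Matrix n n k) :
    M.map (inr : k → k[ε]) * N.map inr = 0 :=
  Matrix.ext fun i j => by simp [Matrix.mul_apply, Matrix.map_apply]

omit [Fintype n] [DecidableEq n] in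
/-- `ε (-A) = - ε A`. [folklore] -/
lemma map_inr_neg (A : Matrix n n k) : (-A).map (inr : k → k[ε]) = -A.map inr :=
  Matrix.ext fun i j => by simp [Matrix.map_apply]

/-- `(1 + ε A) (1 - ε A) = 1`. [folklore] -/
lemma dualMatrix_mul_dualMatrix_neg (A : Matrix n n k) : dualMatrix A * dualMatrix (-A) = 1 := by
  rw [dualMatrix, dualMatrix, Matrix.mul_add, Matrix.add_mul, Matrix.add_mul, Matrix.one_mul,
    Matrix.mul_one, Matrix.one_mul, map_inr_mul_map_inr, add_zero, map_inr_neg, add_assoc,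
    add_neg_cancel, add_zero]

omit [Fintype n] [DecidableEq n] in
/-- `ε A = ε • A` for matrices: `A.map inr = ε • A.map inl`. [folklore] -/
lemma map_inr_eq_eps_smul (A : Matrix n n k) :
    A.map (inr : k → k[ε]) = (ε : k[ε]) • A.map (algebraMap k k[ε]) :=
  Matrix.ext fun i j => by
    simp only [Matrix.map_apply, Matrix.smul_apply, TrivSqZeroExt.algebraMap_eq_inl, smul_eq_mul]
    exact (eps_mul_inl (A i j)).symm

/-- `det (1 + ε A) = 1 + ε tr A` (Mathlib `Matrix.det_one_add_smul` with `ε² = 0`). [folklore] -/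
lemma det_dualMatrix (A : Matrix n n k) :
    (dualMatrix A).det = inl 1 + inr (Matrix.trace A) := by
  rw [dualMatrix, map_inr_eq_eps_smul, Matrix.det_one_add_smul]
  have h2 : (ε : k[ε]) ^ 2 = 0 := by rw [pow_two, DualNumber.eps_mul_eps]
  rw [h2, mul_zero, add_zero, ← AddMonoidHom.map_trace (algebraMap k k[ε]) A]
  change (1 : k[ε]) + inl (Matrix.trace A) * ε = inl 1 + inr (Matrix.trace A)
  rw [mul_comm, eps_mul_inl]
  rfl

/-- `adj (1 + ε A) = (1 + ε tr A) (1 - ε A)`. [folklore] -/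
lemma adjugate_dualMatrix (A : Matrix n n k) :
    (dualMatrix A).adjugate = ((inl 1 + inr (Matrix.trace A) : k[ε])) • dualMatrix (-A) := by
  have h := Matrix.mul_adjugate (dualMatrix A)
  have hinv : dualMatrix (-A) * dualMatrix A = 1 := by
    have := dualMatrix_mul_dualMatrix_neg (-A)
    rwa [neg_neg] at this
  calc (dualMatrix A).adjugate
      = dualMatrix (-A) * dualMatrix A * (dualMatrix A).adjugate := by rw [hinv, Matrix.one_mul]
    _ = dualMatrix (-A) * ((dualMatrix A).det • (1 : Matrix n n k[ε])) := by
      rw [Matrix.mul_assoc, h]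
    _ = (inl 1 + inr (Matrix.trace A) : k[ε]) • dualMatrix (-A) := by
      rw [Matrix.mul_smul, Matrix.mul_one, det_dualMatrix]

/-- The generic matrix evaluates at the point `1 + ε A` to `1 + ε A`. [folklore] -/
lemma aeval_dualPoint_mapMatrix_genericMatrixGL (A : Matrix n n k) :
    ((MvPolynomial.aeval (dualPoint A) : MvPolynomial (GLCoord n) k →ₐ[k] k[ε]) :
      MvPolynomial (GLCoord n) k →+* k[ε]).mapMatrix (genericMatrixGL n k) = dualMatrix A := by
  ext i j : 1
  simp only [RingHom.mapMatrix_apply, Matrix.map_apply, genericMatrixGL, Matrix.of_apply,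
    RingHom.coe_coe, MvPolynomial.aeval_X, dualPoint_eq_coordsOf, coordsOf_inl]

/-- **The coordinates of the inverse at `1 + ε A` are those of `1 - ε A`**: the differential of
inversion at `1` is `A ↦ -A` (Springer 4.4.12: `(di)_e = -id`). [cite: SpringerLAG1998, 4.4.12] -/
lemma aeval_dualPoint_invPolyGL (A : Matrix n n k) (i j : n) :
    MvPolynomial.aeval (dualPoint A) (invPolyGL (k := k) (Sum.inl (i, j))) =
      dualMatrix (-A) i j := by
  have hadj : MvPolynomial.aeval (dualPoint A) ((genericMatrixGL n k).adjugate i j) =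
      (((inl 1 + inr (Matrix.trace A) : k[ε])) • dualMatrix (-A)) i j := by
    have h := congrFun (congrFun
      (RingHom.map_adjugate ((MvPolynomial.aeval (dualPoint A) :
        MvPolynomial (GLCoord n) k →ₐ[k] k[ε]) : MvPolynomial (GLCoord n) k →+* k[ε])
        (genericMatrixGL n k)) i) j
    rw [aeval_dualPoint_mapMatrix_genericMatrixGL, adjugate_dualMatrix] at h
    exact h
  rw [invPolyGL, map_mul, MvPolynomial.aeval_X, hadj, Matrix.smul_apply, smul_eq_mul, ← mul_assoc,
    dualPoint_eq_coordsOf, coordsOf_inr]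
  have hunit : (inl 1 + inr (-Matrix.trace A) : k[ε]) * (inl 1 + inr (Matrix.trace A)) = 1 := by
    apply TrivSqZeroExt.ext <;> simp
  rw [hunit, one_mul]

end DualCalculus

/-! ### Conjugating a fixed matrix: `d (g ↦ g M g⁻¹)_1 (A) = [A, M]` -/

section ConjConst

/-- The polynomials `(X M X⁻¹) i j` in the coordinates of `GL n`, for a fixed matrix `M`.
[folklore] -/
def conjConstPolyGL (M : Matrix n n k) (i j : n) : MvPolynomial (GLCoord n) k :=
  ∑ a : n, ∑ b : n, MvPolynomial.X (Sum.inl (i, a)) * MvPolynomial.C (M a b) *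
    invPolyGL (Sum.inl (b, j))

/-- `conjConstPolyGL M` computes `g M g⁻¹`. [folklore] -/
lemma eval_conjConstPolyGL (g : GL n k) (M : Matrix n n k) (i j : n) :
    MvPolynomial.eval (glCoordFun g) (conjConstPolyGL M i j) =
      ((g : Matrix n n k) * M * ((g⁻¹ : GL n k) : Matrix n n k)) i j := by
  simp only [conjConstPolyGL, map_sum, map_mul, MvPolynomial.eval_X, MvPolynomial.eval_C,
    glCoordFun_inl, eval_invPolyGL, Matrix.mul_apply, Finset.sum_mul]
  rw [Finset.sum_comm]

/-- **The differential of `g ↦ g M g⁻¹` at `1` is `A ↦ A M - M A`.** [folklore] -/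
lemma tangentDeriv_conjConstPolyGL (M : Matrix n n k) (i j : n) (A : Matrix n n k) :
    tangentDeriv (conjConstPolyGL M i j) A = (A * M - M * A) i j := by
  -- evaluate at the dual point: `(1 + ε A) M (1 - ε A) = M + ε (A M - M A)`
  have h : MvPolynomial.aeval (dualPoint A) (conjConstPolyGL M i j) =
      (dualMatrix A * M.map (algebraMap k k[ε]) * dualMatrix (-A)) i j := by
    simp only [conjConstPolyGL, map_sum, map_mul, MvPolynomial.aeval_X, MvPolynomial.aeval_C,
      aeval_dualPoint_invPolyGL, Matrix.mul_apply, Finset.sum_mul, Matrix.map_apply]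
    rw [Finset.sum_comm]
    refine Finset.sum_congr rfl fun b _ => Finset.sum_congr rfl fun a _ => ?_
    rw [dualPoint_eq_coordsOf, coordsOf_inl]
  have hprod : dualMatrix A * M.map (algebraMap k k[ε]) * dualMatrix (-A) =
      M.map (algebraMap k k[ε]) + (A * M - M * A).map inr := by
    rw [dualMatrix, dualMatrix, map_inr_neg]
    have e1 : A.map inr * M.map (algebraMap k k[ε]) = (A * M).map inr :=
      map_inr_mul_map_algebraMap A M
    have e2 : M.map (algebraMap k k[ε]) * A.map inr = (M * A).map inr :=
      map_algebraMap_mul_map_inr M A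
    have e3 : (A * M).map (inr : k → k[ε]) * A.map inr = 0 := map_inr_mul_map_inr _ _
    have e : (1 + A.map (inr : k → k[ε])) * M.map (algebraMap k k[ε]) * (1 + -A.map inr) =
        M.map (algebraMap k k[ε]) + (A.map inr * M.map (algebraMap k k[ε]) -
          M.map (algebraMap k k[ε]) * A.map inr) -
          A.map inr * M.map (algebraMap k k[ε]) * A.map inr := by
      noncomm_ring
    rw [e, e1, e2, e3, sub_zero, ← map_inr_sub]
  rw [tangentDeriv, h, hprod, Matrix.add_apply, snd_add, Matrix.map_apply, Matrix.map_apply,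
    TrivSqZeroExt.algebraMap_eq_inl, snd_inl, zero_add, snd_inr]

end ConjConst

/-! ### `Lie(H)` normalises what `H` normalises -/

section Stabilizer

/-- A vector killed by every linear form vanishing on a subspace lies in it. [folklore] -/
lemma mem_of_forall_dual_eq_zero {V : Type*} [AddCommGroup V] [Module k V] {W : Submodule k V}
    {v : V} (hv : ∀ f : Module.Dual k V, Submodule.map f W = ⊥ → f v = 0) : v ∈ W := by
  by_contra hnot
  obtain ⟨f, hf, hfW⟩ := Submodule.exists_dual_map_eq_bot_of_notMem hnot inferInstance
  exact hf (hv f hfW)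

/-- **`Lie(H)` normalises every subspace of matrices that `H` normalises**: if
`g L g⁻¹ ⊆ L` for all `g ∈ H` then `[A, L] ⊆ L` for all `A ∈ Lie(H)` (`d Ad(X)(Y) = [X, Y]`,
Springer 4.4.15, p. 89, with 4.4.10 (3)). For `M ∈ L` and a linear form `λ` vanishing on `L`, the
polynomial `g ↦ λ (g M g⁻¹)` vanishes on `H`, so its differential `A ↦ λ ([A, M])` vanishes on
`Lie(H)`. [folklore] -/
theorem lie_mem_of_forall_conj_mem {H : Subgroup (GL n k)} {L : Submodule k (Matrix n n k)}
    (hL : ∀ g ∈ H, ∀ M ∈ L,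
      (g : Matrix n n k) * M * ((g⁻¹ : GL n k) : Matrix n n k) ∈ L)
    {A : Matrix n n k} (hA : A ∈ lieAlgebraGL H) {M : Matrix n n k} (hM : M ∈ L) :
    A * M - M * A ∈ L := by
  refine mem_of_forall_dual_eq_zero fun f hf => ?_
  have hf0 : ∀ N ∈ L, f N = 0 := fun N hN => by
    have h : f N ∈ Submodule.map f L := Submodule.mem_map_of_mem hN
    rwa [hf, Submodule.mem_bot] at h
  -- the polynomial `g ↦ f (g M g⁻¹)` and its membership in `𝓘(H)`
  let p : MvPolynomial (GLCoord n) k :=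
    ∑ i : n, ∑ j : n, MvPolynomial.C (f (Matrix.single i j 1)) * conjConstPolyGL M i j
  have hfN : ∀ N : Matrix n n k, f N = ∑ i : n, ∑ j : n, f (Matrix.single i j 1) * N i j := by
    intro N
    conv_lhs => rw [Matrix.matrix_eq_sum_single N]
    simp only [map_sum]
    refine Finset.sum_congr rfl fun i _ => Finset.sum_congr rfl fun j _ => ?_
    rw [show Matrix.single i j (N i j) = N i j • Matrix.single i j (1 : k) by
      rw [Matrix.smul_single, smul_eq_mul, mul_one], map_smul, smul_eq_mul, mul_comm]
  have hp : p ∈ MvPolynomial.vanishingIdeal k (glCoordFun '' (H : Set (GL n k))) := by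
    rw [MvPolynomial.mem_vanishingIdeal_iff]
    rintro _ ⟨g, hg, rfl⟩
    change MvPolynomial.eval (glCoordFun g) p = 0
    have h := hf0 _ (hL g hg M hM)
    rw [hfN] at h
    simpa only [p, map_sum, map_mul, MvPolynomial.eval_C, eval_conjConstPolyGL] using h
  have hd := (mem_lieAlgebraGL_iff.mp hA) p hp
  rw [hfN]
  simpa only [p, tangentDeriv_sum, tangentDeriv_C_mul, tangentDeriv_conjConstPolyGL] using hd

end Stabilizer

/-! ### `Lie(H)` preserves subspaces and fixed vectors of `kⁿ` that `H` preserves -/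

section Vectors

/-- The polynomials `(X v) i = ∑ₐ X i a · v a` in the coordinates of `GL n`, for a fixed vector `v`.
[folklore] -/
def mulVecPolyGL (v : n → k) (i : n) : MvPolynomial (GLCoord n) k :=
  ∑ a : n, MvPolynomial.C (v a) * MvPolynomial.X (Sum.inl (i, a))

/-- `mulVecPolyGL v` computes `g v`. [folklore] -/
lemma eval_mulVecPolyGL (g : GL n k) (v : n → k) (i : n) :
    MvPolynomial.eval (glCoordFun g) (mulVecPolyGL v i) = ((g : Matrix n n k).mulVec v) i := by
  simp only [mulVecPolyGL, map_sum, map_mul, MvPolynomial.eval_X, MvPolynomial.eval_C,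
    glCoordFun_inl, Matrix.mulVec, dotProduct]
  exact Finset.sum_congr rfl fun a _ => mul_comm _ _

/-- **The differential of `g ↦ g v` at `1` is `A ↦ A v`.** [folklore] -/
lemma tangentDeriv_mulVecPolyGL (v : n → k) (i : n) (A : Matrix n n k) :
    tangentDeriv (mulVecPolyGL v i) A = (A.mulVec v) i := by
  simp only [mulVecPolyGL, tangentDeriv_sum, tangentDeriv_C_mul, tangentDeriv_X, tangentCoord,
    Sum.elim_inl, Matrix.mulVec, dotProduct]
  exact Finset.sum_congr rfl fun a _ => mul_comm _ _

/-- **`Lie(H)` preserves every subspace of `kⁿ` that `H` preserves** (the Lie algebra of the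
stabiliser of a subspace lies in its stabiliser in `𝔤𝔩ₙ`; the differential of a rational
representation, Springer 4.4.15 (1)): if `g W ⊆ W` for all `g ∈ H` then `A W ⊆ W` for all
`A ∈ Lie(H)`. [folklore] -/
theorem mulVec_mem_of_forall_mulVec_mem {H : Subgroup (GL n k)} {W : Submodule k (n → k)}
    (hW : ∀ g ∈ H, ∀ w ∈ W, (g : Matrix n n k).mulVec w ∈ W)
    {A : Matrix n n k} (hA : A ∈ lieAlgebraGL H) {w : n → k} (hw : w ∈ W) :
    A.mulVec w ∈ W := by
  refine mem_of_forall_dual_eq_zero fun f hf => ?_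
  have hf0 : ∀ v ∈ W, f v = 0 := fun v hv => by
    have h : f v ∈ Submodule.map f W := Submodule.mem_map_of_mem hv
    rwa [hf, Submodule.mem_bot] at h
  let p : MvPolynomial (GLCoord n) k :=
    ∑ i : n, MvPolynomial.C (f (Pi.single i 1)) * mulVecPolyGL w i
  have hfv : ∀ v : n → k, f v = ∑ i : n, f (Pi.single i 1) * v i := by
    intro v
    rw [LinearMap.pi_apply_eq_sum_univ f v]
    refine Finset.sum_congr rfl fun i _ => ?_
    rw [smul_eq_mul, mul_comm]
    congr 2
    funext j
    simp [Pi.single_apply, eq_comm]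
  have hp : p ∈ MvPolynomial.vanishingIdeal k (glCoordFun '' (H : Set (GL n k))) := by
    rw [MvPolynomial.mem_vanishingIdeal_iff]
    rintro _ ⟨g, hg, rfl⟩
    change MvPolynomial.eval (glCoordFun g) p = 0
    have h := hf0 _ (hW g hg w hw)
    rw [hfv] at h
    simpa only [p, map_sum, map_mul, MvPolynomial.eval_C, eval_mulVecPolyGL] using h
  have hd := (mem_lieAlgebraGL_iff.mp hA) p hp
  rw [hfv]
  simpa only [p, tangentDeriv_sum, tangentDeriv_C_mul, tangentDeriv_mulVecPolyGL] using hd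

/-- **`Lie(H)` kills every vector fixed by `H`**: if `g v = v` for all `g ∈ H` then `A v = 0` for
all `A ∈ Lie(H)` (the differential of the constant orbit map). [folklore] -/
theorem mulVec_eq_zero_of_forall_mulVec_eq {H : Subgroup (GL n k)} {v : n → k}
    (hv : ∀ g ∈ H, (g : Matrix n n k).mulVec v = v)
    {A : Matrix n n k} (hA : A ∈ lieAlgebraGL H) : A.mulVec v = 0 := by
  funext i
  have hp : mulVecPolyGL v i - MvPolynomial.C (v i) ∈
      MvPolynomial.vanishingIdeal k (glCoordFun '' (H : Set (GL n k))) := by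
    rw [MvPolynomial.mem_vanishingIdeal_iff]
    rintro _ ⟨g, hg, rfl⟩
    change MvPolynomial.eval (glCoordFun g) _ = 0
    rw [map_sub, eval_mulVecPolyGL, MvPolynomial.eval_C, hv g hg, sub_self]
  have hd := (mem_lieAlgebraGL_iff.mp hA) _ hp
  rwa [tangentDeriv_sub, tangentDeriv_C, sub_zero, tangentDeriv_mulVecPolyGL] at hd

end Vectors

end Literature.NumberTheory.Automorphic
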